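import Summits.BirchSwinnertonDyer.Rank1Residual.Partition.MainConjecturesEisensteinRankZeroTwist
import Literature.NumberTheory.EllipticCurves.Wuthrich2014.ShaBoundProofs
import Literature.NumberTheory.EllipticCurves.AnalyticRankOrderProofs
import HarnessLib

/-!
# Row D4 ∩ {r = 0}: the mirror twist road in ISOGENY-CLASS form (certificate read on a possibly
# optimal member, conclusion on the census record)

HONEST FRAMING (cell `bsd-litref`, programme `BSD-LIT2PART-PROGRAMME-v1.md` §T2d, verbatim): "no
tranche here proves BSD; ARM L moves the LITERAL column of an r ≤ 1 census into the kernel-proved-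
modulo-named-print column". `Proofs`-style Summits file: THEOREMS ONLY. Seat `bsd-litref-cgs25-pv`.

## Why

Referee A ROUND 413 (2026-08-27) booked row T-CGLS55-TW0 (`RowC6.bsdp_rankZero_of_mainConjectures_
of_twoStepTwist`, p465061) and priced its Manin binder `hc : p ∤ c(Dt)` per class: Mazur Cor. 4.1 /
Abbes–Ullmo Thm. A at the good prime `p` BY NAME for the `X₀(N)`-OPTIMAL curve, plus the record that
the key's curve (member 1 of its Cremona class) IS optimal (opt code 1). For classes with Cremona opt
code `n ≥ 2` («one of `n` possibly optimal curves») member 1's optimality is not of record, and R413.6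
(a) asks for «certificates on every possibly-optimal member if you want them flag-free». This file is
the kernel side of that: the two-step certificate is READ ON AN ISOGENOUS CURVE `W'` (the optimal
member, whichever candidate it is) and the conclusion `BSDp W p` is TRANSPORTED to the census record
`W` by Cassels' isogeny invariance of the BSD quotient (`bsdRHS_eq_of_isIsogenous`, Milne ADT I.7.3,
through the tree's `Wuthrich2014.bsdp_of_isIsogenous`), finiteness of `Ш(W')` from GZK at analytic
rank `0`, and `L(W',1) ≠ 0` as the leading coefficient (modularity, `leadingLCoeff_ne_zero_holds`).

* `RowC6.isogenous_bsdp_rankZero_of_mainConjectures_of_twoStepTwist` — `W ∼ W'` (`ℚ`-isogenous, both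
  globally minimal); ALL per-class data of the two-step door on `W'` (`p > 2` good, `W'[p]` reducible,
  `a_p ≢ 1`, `r_an(W') = 0`, `Dt' : ModularParametrizationData W' N` with `p ∤ c`, `K`, `Wd`, `K'`,
  `Wdd`, `hunit`) ⇒ `BSDp W p`. Named facts: those of p465061 + Cassels (`hCassels`) + modularity as
  analytic continuation (`hmod`). USE: with certificates on every possibly-optimal member of the class,
  the optimal one (record: it is among them) carries `hc` by print, and the census record inherits
  `BSDp` — no `MANIN-DB@p` rider.

References: [CastellaGrossiLeeSkinner2022] Thm. 4.2.2, 5.1.1, 5.1.3, (5.4)–(5.5); [MilneADT2006]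
Thm. I.7.3, Rem. I.7.4; [Miller2011LMS] §1, Def. 1.1; [Mazur1978] Cor. 4.1; [AbbesUllmo1996] Thm. A;
referee A ROUND 413 (pub/pub-bsdpct/REFEREE.md).
-/

set_option autoImplicit false

noncomputable section

open scoped Classical

open WeierstrassCurve NumberField Literature.NumberTheory.EllipticCurves
  Literature.NumberTheory.EllipticCurves.ModularForms Literature.NumberTheory.QuadraticFields
  Literature.NumberTheory.EllipticCurves.Rank1Residual
  Literature.NumberTheory.EllipticCurves.CastellaGrossiLeeSkinner2022

namespace Summit.BirchSwinnertonDyer.Rank1Residual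

/-- **Row D4 ∩ {r = 0}, isogeny-class form of the two-step mirror twist door.** `W ∼ W'` over `ℚ`
(both globally minimal elliptic); on `W'`: `p > 2` good, `W'[p]` reducible, `a_p ≢ 1 (mod p)`,
`ord_{s=1}L(W',s) = 0`, a parametrisation datum `Dt'` of level `N` with `p ∤ c(Dt')`, the Heegner field
`K = ℚ(√d_K)` (`d_K` odd `< −4`, Heegner for `N` and `p`), a globally minimal model `Wd` of
`W'^{(d_K)}` with `ord_{s=1}L(Wd,s) = 1`, a second field `K'` (Heegner for `N_{Wd}` and `p`) with
`L(Wd^{(d_{K'})},1) ≠ 0`, a minimal model `Wdd` of `Wd^{(d_{K'})}` with `ord_p #Ш_an(Wdd) = 0`. Then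
`BSDp W p`. Proof: `RowC6.bsdp_rankZero_of_mainConjectures_of_twoStepTwist` on `W'`, then Cassels'
isogeny invariance (`Wuthrich2014.bsdp_of_isIsogenous`, `hCassels`) with `Ш(W')` finite (GZK at
analytic rank `0`) and `L(W',1) ≠ 0` as leading coefficient (`hmod`, `leadingLCoeff_ne_zero_holds`).
[cite: CastellaGrossiLeeSkinner2022, Thm. 4.2.2, Thm. 5.1.1, Thm. 5.1.3, proof of Thm. 5.3.1 (5.4)–(5.5)]
[cite: MilneADT2006, Thm. I.7.3 and Remark I.7.4] [cite: Miller2011LMS, §1 and Def. 1.1] -/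
theorem RowC6.isogenous_bsdp_rankZero_of_mainConjectures_of_twoStepTwist
    (hCassels : bsdRHS_eq_of_isIsogenous) (hmod : hasEntireLFunction_rat)
    (h54 : display54_thm513_generator_constantCoeff) (h511 : thm511_anticyclotomicControl)
    (hW : Wuthrich2014.sha_dvd_analyticSha)
    (hmodP : nonempty_modularParametrizationData) (hnf : exists_isNewformOf)
    (hGZQ : GrossZagier1986_thm_I_7_3)
    (hGZ : ∀ (N : ℕ) [NeZero N] (W : WeierstrassCurve ℚ) (K : Type) [Field K] [NumberField K],
      gross_zagier N W K)
    (hKo : ∀ (N : ℕ) [NeZero N] (W : WeierstrassCurve ℚ) (K : Type) [Field K] [NumberField K],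
      kolyvagin N W K)
    (hGZK : rank_eq_analyticRank_of_analyticRank_le_one)
    (W : WeierstrassCurve ℚ) [W.IsElliptic] [W.IsGloballyMinimal]
    (W' : WeierstrassCurve ℚ) [W'.IsElliptic] [W'.IsGloballyMinimal] (hiso : IsIsogenous W W')
    (p : ℕ) [Fact p.Prime] (hp : 2 < p) (hgood : Good W' p) (hred : Red W' p) (hna : ¬ Anom W' p)
    (hr0 : W'.analyticRank = 0)
    (N : ℕ) [NeZero N] (Dt' : ModularParametrizationData W' N) (hc : ¬ (p : ℤ) ∣ Dt'.c)
    (K : Type) [Field K] [NumberField K] (hK : IsImaginaryQuadratic K)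
    (hodd : Odd (NumberField.discr K)) (hlt : NumberField.discr K < -4)
    (hHN : SatisfiesHeegnerHypothesis N K) (hHp : SatisfiesHeegnerHypothesis p K)
    (Wd : WeierstrassCurve ℚ) [Wd.IsElliptic] [Wd.IsGloballyMinimal] (Cd : VariableChange ℚ)
    (hWd : Cd • W'.quadraticTwist (NumberField.discr K : ℚ) = Wd) (hrd : Wd.analyticRank = 1)
    (K' : Type) [Field K'] [NumberField K'] (hK' : IsImaginaryQuadratic K')
    (hodd' : Odd (NumberField.discr K')) (hlt' : NumberField.discr K' < -4)
    (hHN' : SatisfiesHeegnerHypothesis (Wd.conductorNorm ℤ) K') (hHp' : SatisfiesHeegnerHypothesis p K')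
    (hLt' : (Wd.quadraticTwist (NumberField.discr K' : ℚ)).entireLFunction 1 ≠ 0)
    (Wdd : WeierstrassCurve ℚ) [Wdd.IsElliptic] [Wdd.IsGloballyMinimal]
    (hWdd : ∃ C : VariableChange ℚ, C • Wdd = Wd.quadraticTwist (NumberField.discr K' : ℚ))
    (hunit : ∃ q : ℚ, shaAn Wdd = (q : ℂ) ∧ padicValRat p q = 0) : BSDp W p :=
  Wuthrich2014.bsdp_of_isIsogenous hCassels hiso (hGZK W' (by omega)).2
    (W'.leadingLCoeff_ne_zero_holds (hmod W'))
    (RowC6.bsdp_rankZero_of_mainConjectures_of_twoStepTwist h54 h511 hW hmodP hnf hGZQ hGZ hKo hGZK W' p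
      hp hgood hred hna hr0 N Dt' hc K hK hodd hlt hHN hHp Wd Cd hWd hrd K' hK' hodd' hlt' hHN' hHp' hLt'
      Wdd hWdd hunit)

end Summit.BirchSwinnertonDyer.Rank1Residual

end
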